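import Mathlib.RingTheory.KrullDimension.Regular
import Summits.ResolutionOfSingularities.ResolutionOfSingularities.Theorems.FrobeniusLadderFInjectiveMacaulayficationFedderClosure
import Summits.ResolutionOfSingularities.ResolutionOfSingularities.Theorems.FrobeniusLadderFRationalModificationExchange
import Summits.ResolutionOfSingularities.ResolutionOfSingularities.Theorems.FrobeniusLadderFRationalModificationDeformFW
import HarnessLib

/-!
# Fedder's criterion for hypersurfaces, necessity, in Frobenius-closure form — and the full criterion

Support file for crux stmt-ResolutionOfSingularities-15315 (`FrobeniusLadder.FInjectiveMacaulayfication`,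
line `Sketch`), completing certification engine E2 (`…FedderClosure.lean`, sufficiency) to a DECISION
PROCEDURE for the crux's per-stalk clause at hypersurface points of regular local rings.

Let `(R, 𝔪)` be a regular local ring of prime characteristic `p`, `f ∈ 𝔪`, `f ≠ 0`.

* `exists_socle_of_le_radical` — an `𝔪`-primary proper ideal `I` of a Noetherian local ring has a socle
  element `s ∉ I`, `𝔪 s ⊆ I` (take `𝔪^N ⊆ I` with `N` minimal).
* `not_frobeniusClosed_of_fedder_mem` — **necessity**: if `f^(p-1) ∈ 𝔪^[p]` then some parameter ideal
  of `R/(f)` is NOT Frobenius closed. Complete `f` to a system of parameters `(f, t)` of `R`, let `s` be a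
  socle element of `I = (f, t)`; then `f^(p-1) s^p ∈ (𝔪 s)^[p] ⊆ I^[p] = (f^p, t^p)`, so
  `f^(p-1) (s^p - a f) ∈ (t^p)` for some `a`, and `f^(p-1)` is regular modulo `(t^p)` (the system of
  parameters `(t^p, f^(p-1))` of the Cohen–Macaulay ring `R` is weakly regular — colon capturing,
  `Exchange.mem_span_of_mul_mem`); hence `s^p ∈ (t)^[p] + (f)` while `s ∉ (t) + (f)`: downstairs the
  class of `s` violates Frobenius-closedness of the parameter ideal `(t̄)`. No F-finiteness, no local
  cohomology, not even Kunz's theorem is needed for this direction.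
* `fedder_hypersurface_clause_iff` — **Fedder's criterion for the crux's clause**: `R/(f)` satisfies
  the per-stalk clause of `FInjectiveMacaulayfication` (all s.o.p. weakly regular and all parameter
  ideals Frobenius closed) **iff** `f^(p-1) ∉ 𝔪^[p]`.
* `frobeniusPower_map` — Frobenius powers commute with extension of ideals (bookkeeping lemma used
  to move the test between a polynomial ring and its local rings).

So for hypersurface germs the clause is decided by finite monomial bookkeeping — the test the
disprover's specimens fail (`E₈⁰` for `p ≤ 5`, the Cossart–Piltant specimen, the cusp) and the chart
points of the cards' toy towers pass (`E₇` at `p = 5`).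

References: [Fedder1983] R. Fedder, F-purity and rational singularity, Trans. AMS 278 (1983),
Prop. 1.7, Lemma 1.6, Thm. 1.12; [Matsumura1987] Thm. 17.4.
-/

-- single-problem summit: the doubled namespace component `ResolutionOfSingularities` is forced
set_option linter.dupNamespace false

namespace Summit.ResolutionOfSingularities.ResolutionOfSingularities.Theorems.FInjectiveMacaulayfication.Fedder

open IsLocalRing RingTheory.Sequence Literature.RingTheory.TightClosure
  Literature.AlgebraicGeometry.Resolution
  Summit.ResolutionOfSingularities.ResolutionOfSingularities.Theorems.FRationalModification

variable {R : Type*} [CommRing R]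

/-! ## §1 Two bookkeeping lemmas -/

/-- Frobenius powers commute with extension of ideals along a ring map between rings of exponential
characteristic `p`: `(I S)^[q] = I^[q] S` for `q = p^e`. [folklore] -/
theorem frobeniusPower_map {A B : Type*} [CommRing A] [CommRing B] (p : ℕ) [ExpChar A p] [ExpChar B p]
    (φ : A →+* B) (e : ℕ) (I : Ideal A) :
    frobeniusPower (p ^ e) (I.map φ) = (frobeniusPower (p ^ e) I).map φ := by
  rw [frobeniusPower_eq_map_iterateFrobenius, frobeniusPower_eq_map_iterateFrobenius, Ideal.map_map,
    Ideal.map_map]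
  congr 1
  ext a
  simp only [RingHom.coe_comp, Function.comp_apply, iterateFrobenius_def, map_pow]

/-- **Socle elements.** In a Noetherian local ring `(R, 𝔪)`, a proper ideal `I` with `𝔪 ⊆ rad I`
has an element `s ∉ I` with `𝔪 s ⊆ I` (let `N ≥ 1` be least with `𝔪^N ⊆ I` and take
`s ∈ 𝔪^(N-1) ∖ I`). [folklore] -/
theorem exists_socle_of_le_radical [IsNoetherianRing R] [IsLocalRing R] {I : Ideal R} (hI : I ≠ ⊤)
    (hrad : maximalIdeal R ≤ I.radical) :
    ∃ s : R, s ∉ I ∧ ∀ m ∈ maximalIdeal R, m * s ∈ I := by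
  classical
  have hex : ∃ n : ℕ, maximalIdeal R ^ n ≤ I :=
    Ideal.exists_pow_le_of_le_radical_of_fg hrad (IsNoetherian.noetherian _)
  have hspec : maximalIdeal R ^ Nat.find hex ≤ I := Nat.find_spec hex
  have h0 : Nat.find hex ≠ 0 := by
    intro h0
    rw [h0, pow_zero, Ideal.one_eq_top, top_le_iff] at hspec
    exact hI hspec
  obtain ⟨k, hk⟩ := Nat.exists_eq_succ_of_ne_zero h0
  have hlt : ¬ maximalIdeal R ^ k ≤ I := Nat.find_min hex (by omega)
  obtain ⟨s, hs, hsI⟩ := SetLike.not_le_iff_exists.mp hlt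
  refine ⟨s, hsI, fun m hm => hspec ?_⟩
  rw [hk, pow_succ']
  exact Ideal.mul_mem_mul hm hs

/-! ## §2 Necessity of Fedder's condition -/

section Necessity

variable (p : ℕ) [Fact p.Prime] [CharP R p] [IsRegularLocalRing R]

/-- **Fedder's criterion for hypersurfaces, necessity, closure form.** Let `(R, 𝔪)` be a regular local
ring of characteristic `p` and `f ∈ 𝔪`, `f ≠ 0`, with `f^(p-1) ∈ 𝔪^[p]`. Then the hypersurface ring
`R/(f)` has a system of parameters `t̄` (of length `dim R/(f)`, radical maximal) whose ideal is NOT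
Frobenius closed: some `ȳ ∉ (t̄)` has `ȳ^p ∈ (t̄)^[p]` — `R/(f)` is not F-injective and violates the
per-stalk clause of crux `FInjectiveMacaulayfication`. (`ȳ` is the class of a socle element of
`(f, t)`; see the module docstring for the five-line argument.)
[cite: Fedder1983, Prop. 1.7 and Thm. 1.12] -/
theorem not_frobeniusClosed_of_fedder_mem {f : R} (hfm : f ∈ maximalIdeal R) (hf0 : f ≠ 0)
    (hf : f ^ (p - 1) ∈ frobeniusPower p (maximalIdeal R)) :
    ∃ (n : ℕ) (t : Fin n → R ⧸ Ideal.span {f}), ringKrullDim (R ⧸ Ideal.span {f}) = n ∧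
      (Ideal.span (Set.range t)).radical.IsMaximal ∧
      ∃ y : R ⧸ Ideal.span {f}, (∃ e : ℕ, y ^ p ^ e ∈
          Ideal.span ((fun z : R ⧸ Ideal.span {f} => z ^ p ^ e) ''
            (Ideal.span (Set.range t) : Set (R ⧸ Ideal.span {f})))) ∧
        y ∉ Ideal.span (Set.range t) := by
  have hp : p.Prime := Fact.out
  have hp1 : 0 < p - 1 := Nat.sub_pos_of_lt hp.one_lt
  haveI : IsDomain R := isDomain_of_isRegularLocalRing R
  obtain ⟨_, hloc⟩ := isLocalRing_quotient_span_singleton hfm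
  set mk := Ideal.Quotient.mk (Ideal.span {f}) with hmk
  have hfreg : IsSMulRegular R f :=
    (isRegular_iff_mem_nonZeroDivisors.mpr (mem_nonZeroDivisors_of_ne_zero hf0)).left.isSMulRegular
  -- dimensions: `dim R/(f) = n`, `dim R = n + 1`
  obtain ⟨n, hn⟩ := exists_nat_cast_eq_ringKrullDim (R := R ⧸ Ideal.span {f})
  have hdim : ringKrullDim R = ((n + 1 : ℕ) : WithBot ℕ∞) := by
    have h := ringKrullDim_quotient_span_singleton_succ_eq_ringKrullDim hfreg hfm
    rw [hn] at h
    exact_mod_cast h.symm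
  -- `R` is Cohen–Macaulay: every system of parameters is weakly regular
  have hCM : ∀ ⦃m : ℕ⦄ (s : Fin m → R), IsSystemOfParameters s → IsWeaklyRegular R (List.ofFn s) :=
    fun m s hs => SopWeaklyRegular.stub_sopWeaklyRegular (exists_isRegular_length_eq_ringKrullDim R) s hs
  -- a system of parameters `t̄` of `R/(f)` and a lift `t`
  obtain ⟨t', ht'⟩ := exists_isSystemOfParameters (R := R ⧸ Ideal.span {f}) hn
  obtain ⟨t, ht⟩ : ∃ t : Fin n → R, ∀ i, mk (t i) = t' i :=
    ⟨fun i => (Ideal.Quotient.mk_surjective (t' i)).choose,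
      fun i => (Ideal.Quotient.mk_surjective (t' i)).choose_spec⟩
  -- the parameter ideal `I = (f, t)` of `R`
  set I : Ideal R := Ideal.span (insert f (Set.range t)) with hI
  have hmapI : I.map mk = Ideal.span (Set.range t') := by
    rw [hI, Ideal.map_span, Set.image_insert_eq, ← Set.range_comp]
    have h0 : mk f = 0 := Ideal.Quotient.eq_zero_iff_mem.mpr (Ideal.mem_span_singleton_self f)
    have hcomp : (mk ∘ t) = t' := funext ht
    rw [h0, hcomp, Ideal.span_insert, Ideal.span_singleton_eq_bot.mpr rfl, bot_sup_eq]
  have hkerI : RingHom.ker mk ≤ I := by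
    rw [hmk, Ideal.mk_ker, Ideal.span_singleton_le_iff_mem]
    exact Ideal.subset_span (Set.mem_insert _ _)
  have hcomapI : (Ideal.span (Set.range t')).comap mk = I := by
    rw [← hmapI, Ideal.comap_map_of_surjective mk Ideal.Quotient.mk_surjective,
      ← RingHom.ker_eq_comap_bot, sup_eq_left.mpr hkerI]
  have hradI : I.radical = maximalIdeal R := by
    have h1 : ((Ideal.span (Set.range t')).radical).comap mk = maximalIdeal R :=
      eq_maximalIdeal (ht'.2.symm ▸ Ideal.comap_isMaximal_of_surjective mk Ideal.Quotient.mk_surjective)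
    rw [← hcomapI, ← Ideal.comap_radical, h1]
  have hItop : I ≠ ⊤ := by
    intro h
    have h1 : I.radical = ⊤ := by rw [h, Ideal.radical_top]
    exact (maximalIdeal.isMaximal R).ne_top (hradI ▸ h1)
  -- a socle element `s` of `I`
  obtain ⟨s, hsI, hsoc⟩ := exists_socle_of_le_radical hItop hradI.symm.le
  -- `f^(p-1) s^p ∈ I^[p] = (f^p, t^p)`
  have hIq : frobeniusPower p I = Ideal.span (insert (f ^ p) (Set.range fun i => t i ^ p)) := by
    have h := frobeniusPower_span (R := R) p 1 (insert f (Set.range t))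
    rw [pow_one, Set.image_insert_eq, ← Set.range_comp] at h
    exact h
  have hmem : f ^ (p - 1) * s ^ p ∈ frobeniusPower p I := by
    have key : ∀ g ∈ frobeniusPower p (maximalIdeal R), g * s ^ p ∈ frobeniusPower p I := by
      intro g hg
      induction hg using Submodule.span_induction with
      | mem x hx =>
        obtain ⟨m, hm, rfl⟩ := hx
        change m ^ p * s ^ p ∈ frobeniusPower p I
        rw [← mul_pow]
        exact pow_mem_frobeniusPower (hsoc m hm)
      | zero => rw [zero_mul]; exact zero_mem _
      | add x y _ _ hx hy => rw [add_mul]; exact add_mem hx hy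
      | smul r x _ hx => rw [smul_eq_mul, mul_assoc]; exact Ideal.mul_mem_left _ r hx
    exact key _ hf
  rw [hIq, Ideal.mem_span_insert] at hmem
  obtain ⟨a, b, hb, hab⟩ := hmem
  -- `f^(p-1) (s^p - a f) = b ∈ (t^p)`
  have hz : f ^ (p - 1) * (s ^ p - a * f) = b := by
    have h1 : f ^ (p - 1) * (a * f) = a * f ^ p := by
      rw [mul_left_comm, pow_sub_one_mul hp.ne_zero]
    rw [mul_sub, h1, hab, add_sub_cancel_left]
  -- colon capturing: `f^(p-1)` is regular modulo `(t^p)`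
  have hrad' : (Ideal.span (insert (f ^ (p - 1)) (Set.range fun i => t i ^ p))).radical =
      maximalIdeal R := by
    rw [DeformFW.radical_span_insert_pow f t hp1 hp.pos, ← hI, hradI]
  have hsp : s ^ p - a * f ∈ Ideal.span (Set.range fun i => t i ^ p) :=
    Exchange.mem_span_of_mul_mem hCM hdim hrad' (by rw [hz]; exact hb)
  -- downstairs
  refine ⟨n, t', hn, ?_, mk s, ⟨1, ?_⟩, ?_⟩
  · rw [ht'.2]
    exact maximalIdeal.isMaximal _
  · -- `(mk s)^p ∈ (t̄)^[p]`
    have h1 : mk (s ^ p - a * f) = mk s ^ p := by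
      rw [map_sub, map_mul, map_pow, Ideal.Quotient.eq_zero_iff_mem.mpr (Ideal.mem_span_singleton_self f),
        mul_zero, sub_zero]
    have h2 : mk (s ^ p - a * f) ∈ (Ideal.span (Set.range fun i => t i ^ p)).map mk :=
      Ideal.mem_map_of_mem mk hsp
    rw [h1, Ideal.map_span] at h2
    rw [pow_one]
    refine Ideal.span_mono ?_ h2
    rintro _ ⟨_, ⟨i, rfl⟩, rfl⟩
    refine ⟨t' i, Ideal.subset_span ⟨i, rfl⟩, ?_⟩
    change t' i ^ p = mk (t i ^ p)
    rw [map_pow, ht i]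
  · -- `mk s ∉ (t̄)`
    intro hs
    exact hsI (hcomapI ▸ Ideal.mem_comap.mpr hs)

/-- **Fedder's criterion for the crux's clause at hypersurface points.** For a regular local ring
`(R, 𝔪)` of prime characteristic `p` and `f ∈ 𝔪`, `f ≠ 0`: the hypersurface ring `R/(f)` satisfies
the per-stalk clause of crux `FInjectiveMacaulayfication` — every system of parameters weakly regular
and every parameter ideal Frobenius closed, i.e. Cohen–Macaulay + F-injective — **iff**
`f^(p-1) ∉ 𝔪^[p]`. (`⇐`: `fedder_hypersurface_clause`, which even gives all ideals Frobenius closed;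
`⇒`: `not_frobeniusClosed_of_fedder_mem`.) [cite: Fedder1983, Prop. 1.7 and Thm. 1.12] -/
theorem fedder_hypersurface_clause_iff {f : R} (hfm : f ∈ maximalIdeal R) (hf0 : f ≠ 0) :
    (∀ d : ℕ, ringKrullDim (R ⧸ Ideal.span {f}) = d → ∀ s : Fin d → R ⧸ Ideal.span {f},
      (Ideal.span (Set.range s)).radical.IsMaximal →
        IsWeaklyRegular (R ⧸ Ideal.span {f}) (List.ofFn s) ∧
        ∀ y : R ⧸ Ideal.span {f}, (∃ e : ℕ, y ^ p ^ e ∈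
            Ideal.span ((fun z : R ⧸ Ideal.span {f} => z ^ p ^ e) ''
              (Ideal.span (Set.range s) : Set (R ⧸ Ideal.span {f})))) →
          y ∈ Ideal.span (Set.range s)) ↔
      f ^ (p - 1) ∉ frobeniusPower p (maximalIdeal R) := by
  constructor
  · intro h hf
    obtain ⟨n, t, hn, ht, y, hy, hyt⟩ := not_frobeniusClosed_of_fedder_mem p hfm hf0 hf
    exact hyt ((h n hn t ht).2 y hy)
  · intro hf d hd s hs
    exact ⟨sop_isWeaklyRegular_quotient hfm hf0 d hd s hs,
      fun y hy => frobeniusClosed_quotient p hf _ y hy⟩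

end Necessity

/-! ## §3 The registered helper stub (every binder explicit, universe `0`) -/

/-- **Fedder's criterion for the crux's clause at hypersurface points** (helper stub `fedder_criterion`
of line `Sketch`, crux `FInjectiveMacaulayfication`): for a regular local ring `(R, 𝔪)` of prime
characteristic `p` and `f ∈ 𝔪`, `f ≠ 0`, the hypersurface ring `R/(f)` satisfies the per-stalk clause
(all s.o.p. weakly regular, all parameter ideals Frobenius closed) iff `f^(p-1) ∉ 𝔪^[p]`.
[cite: Fedder1983, Prop. 1.7 and Thm. 1.12] -/
theorem fedder_criterion : ∀ (p : ℕ) [Fact p.Prime] (R : Type) [CommRing R] [IsRegularLocalRing R] [CharP R p] (f : R), f ∈ IsLocalRing.maximalIdeal R → f ≠ 0 → ((∀ d : ℕ, ringKrullDim (R ⧸ Ideal.span {f}) = d → ∀ s : Fin d → R ⧸ Ideal.span {f}, (Ideal.span (Set.range s)).radical.IsMaximal → RingTheory.Sequence.IsWeaklyRegular (R ⧸ Ideal.span {f}) (List.ofFn s) ∧ ∀ y : R ⧸ Ideal.span {f}, (∃ e : ℕ, y ^ p ^ e ∈ Ideal.span ((fun z : R ⧸ Ideal.span {f} => z ^ p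 ^ e) '' (Ideal.span (Set.range s) : Set (R ⧸ Ideal.span {f})))) → y ∈ Ideal.span (Set.range s)) ↔ f ^ (p - 1) ∉ Literature.RingTheory.TightClosure.frobeniusPower p (IsLocalRing.maximalIdeal R)) :=
  fun p _ _ _ _ _ _ hfm hf0 => fedder_hypersurface_clause_iff p hfm hf0

end Summit.ResolutionOfSingularities.ResolutionOfSingularities.Theorems.FInjectiveMacaulayfication.Fedder
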